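import Literature.Topology.PlaneTopology.WindingNumber
import Literature.NumberTheory.Automorphic.BLZPeriodCocycleProofs
import Mathlib.Analysis.InnerProductSpace.PiL2
import Mathlib.LinearAlgebra.Complex.Determinant
import Mathlib.LinearAlgebra.Complex.FiniteDimensional
import Mathlib.LinearAlgebra.FiniteDimensional.Basic
import Mathlib.Analysis.Complex.Basic

/-!
# Winding numbers under real-linear maps of `ℂ`, and real-linear algebra of `ℝ⁴ → ℂ`
(registered helpers `helper_wind_comp_posDet`, `helper_wind_conj`, `helper_normalise_posDet`,
`helper_orientationSign_basic`, `helper_transverse_iff` of line `cross-cap-laurent`, crux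
`GromovRecognitionRelEnd`, item stmt-SmoothPoincare4-11009)

Five elementary facts used by the joint (two-family) machinery of the crux:

* `helper_wind_comp_posDet`: an orientation-preserving real-linear map `L : ℂ → ℂ`
  (`0 < det L`) preserves the winding number about `0` of loops avoiding `0`.  Proof: every
  real-linear self-map of `ℂ` is `w ↦ a w + b w̄` with `a = (L 1 - I L I)/2`, `b = (L 1 + I L I)/2`
  (the Wirtinger decomposition `Literature.NumberTheory.Automorphic.clm_apply_eq_wirtinger`,
  reused from the tree), and `det L = |a|² - |b|²`; so `|b| < |a|`, `‖L (γ t) - a γ t‖ = |b| |γ t| < ‖a γ t‖`, and Rouché's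
  principle for loops (`wind_eq_of_norm_sub_lt`) gives `wind (L ∘ γ) = wind (a γ) = wind γ`.
* `helper_wind_conj`: `wind (conj ∘ γ) = - wind γ` (conjugate a continuous logarithm).
* `helper_normalise_posDet`: for a real-linear `ℓ : ℝ⁴ → ℂ` with `J`-invariant kernel
  (`J² = -1`), `ℓ ξ = 1` and `0 < Im μ`, `μ := ℓ (J ξ)`, the real-linear `R` with `R 1 = 1`,
  `R μ = I` has `det R = 1 / Im μ > 0` and `R ∘ ℓ` is complex-linear: `R (ℓ (J v)) = I R (ℓ v)`.
* `helper_orientationSign_basic`: `ℓ (J ξ)` does not depend on the preimage `ξ` of `1`, and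
  `Im (ℓ (J ξ)) ≠ 0` (else `J` would have a real eigenvalue on `ℝ⁴ / ker ℓ`).
* `helper_transverse_iff`: for real-linear `ℓ : ℝ⁴ → ℂ`, `m : ℂ → ℝ⁴`, the endomorphism `ℓ ∘ m`
  of the plane is onto iff its kernel is trivial.

The determinant of a real-linear self-map of `ℂ` is read off in the basis `(1, I)`
(`Complex.basisOneI`, `LinearMap.det_toMatrix`, `Matrix.det_fin_two`).
-/

-- the prescribed namespace `Summit.<P>.<Sub>.…` duplicates `SmoothPoincare4` (P = Sub)
set_option linter.dupNamespace false

open Set Function Literature.Topology.PlaneTopology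
open ComplexConjugate

namespace Summit.SmoothPoincare4.SmoothPoincare4.Theorems.GromovRecognitionRelEnd.CrossCapLaurent

/-- The determinant of a real-linear self-map `T` of `ℂ`, computed in the real basis `(1, I)`:
`det T = Re (T 1) · Im (T I) - Re (T I) · Im (T 1)`. -/
theorem det_realLinear_complex_eq (T : ℂ →ₗ[ℝ] ℂ) :
    LinearMap.det T = (T 1).re * (T Complex.I).im - (T Complex.I).re * (T 1).im := by
  rw [← LinearMap.det_toMatrix Complex.basisOneI, Matrix.det_fin_two]
  simp [LinearMap.toMatrix_apply, Complex.coe_basisOneI_repr, Complex.coe_basisOneI]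

/-- J1: an orientation-preserving real-linear automorphism of `ℂ` preserves winding numbers of
loops avoiding `0`. -/
theorem helper_wind_comp_posDet : ∀ (L : ℂ →L[ℝ] ℂ) (γ : ℝ → ℂ),
    IsNonvanishingLoop γ → 0 < LinearMap.det (L : ℂ →ₗ[ℝ] ℂ) →
    wind (fun t => L (γ t)) = wind γ := by
  intro L γ hγ hdet
  set a : ℂ := (L 1 - Complex.I * L Complex.I) / 2 with ha
  set b : ℂ := (L 1 + Complex.I * L Complex.I) / 2 with hb
  have hL : ∀ w, L w = a * w + b * conj w :=
    Literature.NumberTheory.Automorphic.clm_apply_eq_wirtinger L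
  -- `det L = |a|² - |b|²`, so `|b| < |a|`
  have hab : ‖b‖ < ‖a‖ := by
    have h1 : LinearMap.det (L : ℂ →ₗ[ℝ] ℂ) = ‖a‖ ^ 2 - ‖b‖ ^ 2 := by
      rw [det_realLinear_complex_eq, Complex.sq_norm, Complex.sq_norm, Complex.normSq_apply,
        Complex.normSq_apply]
      simp only [ha, hb, ContinuousLinearMap.coe_coe]
      simp
      ring
    have h2 : ‖b‖ ^ 2 < ‖a‖ ^ 2 := by linarith
    exact lt_of_pow_lt_pow_left₀ 2 (norm_nonneg _) h2
  have ha0 : a ≠ 0 := by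
    intro h
    rw [h, norm_zero] at hab
    linarith [norm_nonneg b]
  -- Rouché against the loop `t ↦ a γ t`
  have hca : IsNonvanishingLoop fun _ : ℝ => a := IsNonvanishingLoop.const ha0
  have key : wind (fun t => L (γ t)) = wind (fun t => a * γ t) := by
    refine wind_eq_of_norm_sub_lt (L.continuous.comp_continuousOn hγ.continuousOn) ?_
      (hca.mul hγ) fun t ht => ?_
    · show L (γ 0) = L (γ 1)
      rw [hγ.eq_endpoints]
    · rw [hL, add_sub_cancel_left, norm_mul, norm_mul, Complex.norm_conj]
      exact mul_lt_mul_of_pos_right hab (norm_pos_iff.2 (hγ.ne_zero t ht))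
  rw [key, wind_mul hca hγ, wind_const, zero_add]

/-- J1': complex conjugation reverses winding numbers of loops avoiding `0`. -/
theorem helper_wind_conj : ∀ (γ : ℝ → ℂ), IsNonvanishingLoop γ →
    wind (fun t => (starRingEnd ℂ) (γ t)) = -wind γ := by
  intro γ hγ
  obtain ⟨l, hl, hle⟩ := hγ.hasLogOn
  have e1 := wind_spec hl hle hγ.eq_endpoints
  have h01 : (fun t => conj (γ t)) 0 = (fun t => conj (γ t)) 1 := by
    show conj (γ 0) = conj (γ 1)
    rw [hγ.eq_endpoints]
  have e2 := wind_spec (f := fun t => conj (γ t)) (l := fun t => conj (l t))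
    (Complex.continuous_conj.comp_continuousOn hl)
    (fun t ht => by rw [Complex.exp_conj, hle t ht]) h01
  apply int_eq_of_mul_two_pi_I_eq
  have e3 : conj (l 1) - conj (l 0) = conj (l 1 - l 0) := by rw [map_sub]
  have h2 : conj (2 : ℂ) = 2 := map_ofNat _ 2
  rw [← e2, e3, e1, Int.cast_neg, map_mul, map_mul, map_mul, Complex.conj_I, Complex.conj_ofReal,
    map_intCast, h2]
  ring

/-- J2: normalisation of a real-linear surjection `ℓ : E → ℂ` with `J`-invariant kernel: if the
induced complex structure on `ℂ` is oriented like `I` (`0 < Im (ℓ (J ξ))` for `ℓ ξ = 1`), some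
orientation-preserving `R` makes `R ∘ ℓ` complex-linear for `J`. -/
theorem helper_normalise_posDet : ∀ (ℓ : EuclideanSpace ℝ (Fin 4) →L[ℝ] ℂ)
    (J : EuclideanSpace ℝ (Fin 4) →L[ℝ] EuclideanSpace ℝ (Fin 4)) (ξ : EuclideanSpace ℝ (Fin 4)),
    (∀ v, J (J v) = -v) → Surjective ℓ → (∀ v, ℓ v = 0 → ℓ (J v) = 0) → ℓ ξ = 1 →
    0 < (ℓ (J ξ)).im →
    ∃ R : ℂ →L[ℝ] ℂ, 0 < LinearMap.det (R : ℂ →ₗ[ℝ] ℂ) ∧ ∀ v, R (ℓ (J v)) = Complex.I * R (ℓ v) := by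
  intro ℓ J ξ hJ _ hker hξ hpos
  set μ : ℂ := ℓ (J ξ) with hμ
  have him : μ.im ≠ 0 := hpos.ne'
  -- the real-linear `R` with `R 1 = 1`, `R I = c`, where `c := (I - Re μ) / Im μ`; then `R μ = I`
  set c : ℂ := (Complex.I - μ.re) / μ.im with hc
  have hcre : c.re = -μ.re / μ.im := by
    rw [hc, Complex.div_ofReal_re, Complex.sub_re, Complex.I_re, Complex.ofReal_re, zero_sub]
  have hcim : c.im = (μ.im)⁻¹ := by
    rw [hc, Complex.div_ofReal_im, Complex.sub_im, Complex.I_im, Complex.ofReal_im, sub_zero,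
      one_div]
  let R : ℂ →L[ℝ] ℂ := Complex.reCLM.smulRight (1 : ℂ) + Complex.imCLM.smulRight c
  have hR : ∀ w : ℂ, R w = (w.re : ℂ) + (w.im : ℂ) * c := fun w => by
    simp only [R, add_apply, ContinuousLinearMap.smulRight_apply,
      Complex.reCLM_apply, Complex.imCLM_apply, Complex.real_smul, mul_one]
  refine ⟨R, ?_, fun v => ?_⟩
  · rw [det_realLinear_complex_eq]
    simp only [ContinuousLinearMap.coe_coe, hR]
    simp [hcre, hcim]
    exact hpos
  · -- write `ℓ v = α + β μ` with real `α, β`; then `v - α ξ - β J ξ ∈ ker ℓ`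
    obtain ⟨β, hβ⟩ : ∃ β : ℝ, β * μ.im = (ℓ v).im := ⟨(ℓ v).im / μ.im, div_mul_cancel₀ _ him⟩
    obtain ⟨α, hα⟩ : ∃ α : ℝ, α + β * μ.re = (ℓ v).re := ⟨(ℓ v).re - β * μ.re, sub_add_cancel _ _⟩
    have hv : ℓ (v - α • ξ - β • J ξ) = 0 := by
      rw [map_sub, map_sub, map_smul, map_smul, hξ, ← hμ]
      apply Complex.ext
      · simp
        linarith
      · simp
        linarith
    have hJv : ℓ (J v) = α * μ - β := by
      have h := hker _ hv
      rw [map_sub, map_sub, map_smul, map_smul, hJ, map_sub, map_sub, map_smul, map_smul, map_neg,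
        hξ, ← hμ, Complex.real_smul, Complex.real_smul, mul_neg, mul_one, sub_neg_eq_add] at h
      linear_combination h
    have hℓv : ℓ v = (α + β * μ.re : ℝ) + (β * μ.im : ℝ) * Complex.I :=
      Complex.ext (by simp [hα]) (by simp [hβ])
    rw [hJv, hℓv, hR, hR]
    apply Complex.ext
    · simp [hcre, hcim]
      field_simp
      ring
    · simp [hcre, hcim]
      field_simp
      ring

/-- J2': the orientation sign of `ℓ` does not depend on the chosen preimage of `1` and is never
`0`. -/
theorem helper_orientationSign_basic : ∀ (ℓ : EuclideanSpace ℝ (Fin 4) →L[ℝ] ℂ)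
    (J : EuclideanSpace ℝ (Fin 4) →L[ℝ] EuclideanSpace ℝ (Fin 4)) (ξ ξ' : EuclideanSpace ℝ (Fin 4)),
    (∀ v, J (J v) = -v) → Surjective ℓ → (∀ v, ℓ v = 0 → ℓ (J v) = 0) → ℓ ξ = 1 → ℓ ξ' = 1 →
    ℓ (J ξ) = ℓ (J ξ') ∧ (ℓ (J ξ)).im ≠ 0 := by
  intro ℓ J ξ ξ' hJ _ hker hξ hξ'
  refine ⟨?_, fun him => ?_⟩
  · have h : ℓ (ξ - ξ') = 0 := by rw [map_sub, hξ, hξ', sub_self]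
    have h2 := hker _ h
    rwa [map_sub, map_sub, sub_eq_zero] at h2
  · -- if `ℓ (J ξ) = r` is real then `J ξ - r ξ ∈ ker ℓ`, and applying `J`: `-1 - r² = 0`
    set r : ℝ := (ℓ (J ξ)).re with hr
    have hμ : ℓ (J ξ) = (r : ℂ) := Complex.ext (by rw [hr, Complex.ofReal_re])
      (by rw [him, Complex.ofReal_im])
    have h : ℓ (J ξ - r • ξ) = 0 := by
      rw [map_sub, map_smul, hξ, hμ, Complex.real_smul, mul_one, sub_self]
    have h2 := hker _ h
    rw [map_sub, map_smul, hJ, map_sub, map_neg, map_smul, hξ, hμ, Complex.real_smul] at h2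
    have h3 := congrArg Complex.re h2
    simp only [Complex.sub_re, Complex.neg_re, Complex.one_re, Complex.mul_re, Complex.ofReal_re,
      Complex.ofReal_im, mul_zero, sub_zero, Complex.zero_re] at h3
    nlinarith [sq_nonneg r]

/-- J6: TRANSVERSALITY BOOKKEEPING in real dimension four: for `ℓ : ℝ⁴ → ℂ` onto and
`m : ℂ → ℝ⁴` injective (real-linear), `ℓ ∘ m` is onto iff `range m ⊓ ker ℓ = ⊥`. -/
theorem helper_transverse_iff : ∀ (ℓ : EuclideanSpace ℝ (Fin 4) →L[ℝ] ℂ)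
    (m : ℂ →L[ℝ] EuclideanSpace ℝ (Fin 4)), Surjective ℓ → Injective m →
    (Surjective (ℓ.comp m) ↔ ∀ ζ : ℂ, ℓ (m ζ) = 0 → ζ = 0) := by
  intro ℓ m _ _
  have h1 : Surjective (ℓ.comp m) ↔ Injective (ℓ.comp m) := by
    rw [← ContinuousLinearMap.coe_coe]
    exact (LinearMap.injective_iff_surjective (f := ((ℓ.comp m : ℂ →L[ℝ] ℂ) : ℂ →ₗ[ℝ] ℂ))).symm
  rw [h1, injective_iff_map_eq_zero]
  rfl

end Summit.SmoothPoincare4.SmoothPoincare4.Theorems.GromovRecognitionRelEnd.CrossCapLaurent
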